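import Literature.NumberTheory.Transcendental.LinEDSCells
import HarnessLib

/-!
# Cell block certificates: a strict `spread` for the kernel

Companion to `Literature/NumberTheory/Transcendental/LinEDSCells.lean` §15–17 (blocks with precomputed
filler rows). `LinEDS.spread L ν acc` recurses on the column list with the conditional INSIDE the
accumulator argument; under the kernel's lazy reduction this builds, per spread, a nest of a
thousand unevaluated conditionals over unevaluated halving chains, and a file with a few dozen
spreads becomes super-linearly slow (weight 17, block `(6,[1])`: 10 / 20 / 30 / 46 spreads of a
1001-column list took 35 / 59 / 174 / 929 s of kernel time; the same rows without the spreads 29 s).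
`spreadS` tests the bit FIRST and recurses in each branch — the same function (`spreadS_eq`), but the
kernel forces the halving chain at every step and the accumulator is a plain chain of `|||`.
`rowsXS`, `checkBlockCXS(Enc,Enc2)`, `checkExtraS(Enc,Enc2)` are the §15–17 checks with `spreadS`,
PROVABLY EQUAL to the originals (`checkBlockCXS_eq`, `checkExtra_of_checkExtraS`), so certificates
decide the `S` forms and conclude the registered `checkBlockCX` / `checkExtra` statements.

References: K. Ihara, M. Kaneko, D. Zagier, Compos. Math. 142 (2006) §2, Conjecture 1
[IharaKanekoZagier2006].
-/

namespace Literature.NumberTheory.Transcendental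

namespace LinEDS

/-! ### §18 Strict spread -/

/-- Spread a block-local bitset over the listed columns, testing the low bit BEFORE recursing (the
kernel-friendly form of `spread`). [folklore] -/
def spreadS : List ℕ → ℕ → ℕ → ℕ
  | [], _, acc => acc
  | c :: cs, ν, acc => bif ν % 2 == 1 then spreadS cs (ν / 2) (acc ||| 2 ^ c) else spreadS cs (ν / 2) acc

/-- `spreadS` is `spread`. [folklore] -/
theorem spreadS_eq : ∀ (L : List ℕ) (ν acc : ℕ), spreadS L ν acc = spread L ν acc
  | [], _, _ => rfl
  | c :: cs, ν, acc => by
    rw [spreadS, spread]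
    cases ν % 2 == 1 <;> simp [spreadS_eq cs]

/-- The rows of a block with extras, strict spread. [folklore] -/
def rowsXS (k : ℕ) (L : List ℕ) : List (List (List ℕ × List ℕ)) → List ℕ → List ℕ
  | g :: gs, e :: es => (bif e == 0 then rowBitsG k g else rowBitsG k g ^^^ spreadS L e 0) :: rowsXS k L gs es
  | _, _ => []

/-- `rowsXS` is `rowsX`. [folklore] -/
theorem rowsXS_eq (k : ℕ) (L : List ℕ) :
    ∀ (gs : List (List (List ℕ × List ℕ))) (es : List ℕ), rowsXS k L gs es = rowsX k L gs es
  | [], [] => rfl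
  | [], _ :: _ => rfl
  | _ :: _, [] => rfl
  | g :: gs, e :: es => by rw [rowsXS, rowsX, spreadS_eq, rowsXS_eq k L gs es]

/-- **One cell block with extras, strict spread** (same Boolean as `checkBlockCX`).
[cite: IharaKanekoZagier2006, Conjecture 1] -/
def checkBlockCXS (k W' f : ℕ) (cells later : List (ℕ × List ℕ)) (L : List ℕ)
    (groups : List (List (List ℕ × List ℕ))) (extra : List ℕ) : Bool :=
  let mask := cellsMask k cells &&& colMask k
  let higher := cellsMask k later
  let n := lengthTR L
  let rows := rowsXS k L groups extra
  Nat.beq (lengthTR groups) n && sameLength groups extra && Nat.beq (maskOf L) mask && incMod W' L &&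
    Nat.blt n W' && groups.all (fun g => g.all (validName k)) &&
    (groups.map (rowBitsG k)).all (fun r => r &&& higher == 0) &&
    elimLoop W' (rep W' n) (L.map (· % W')) (pack W' (rows.map fun r => xorFold W' f (r &&& mask)))

/-- `checkBlockCXS` is `checkBlockCX`. [folklore] -/
theorem checkBlockCXS_eq (k W' f : ℕ) (cells later : List (ℕ × List ℕ)) (L : List ℕ)
    (groups : List (List (List ℕ × List ℕ))) (extra : List ℕ) :
    checkBlockCXS k W' f cells later L groups extra = checkBlockCX k W' f cells later L groups extra := by
  simp only [checkBlockCXS, checkBlockCX, rowsXS_eq]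

/-- Encoded names (`decodeName`), strict spread. [cite: IharaKanekoZagier2006, Conjecture 1] -/
def checkBlockCXSEnc (k W' f : ℕ) (cells later : List (ℕ × List ℕ)) (L : List ℕ)
    (codes : List (List ℕ)) (extra : List ℕ) : Bool :=
  checkBlockCXS k W' f cells later L (codes.map fun g => g.map decodeName) extra

/-- Encoded names (`decodeName2`), strict spread. [cite: IharaKanekoZagier2006, Conjecture 1] -/
def checkBlockCXSEnc2 (k W' f : ℕ) (cells later : List (ℕ × List ℕ)) (L : List ℕ)
    (codes : List (List ℕ)) (extra : List ℕ) : Bool :=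
  checkBlockCXS k W' f cells later L (codes.map fun g => g.map decodeName2) extra

/-- From the strict encoded check to the registered form. [folklore] -/
theorem checkBlockCX_of_S {k W' f : ℕ} {cells later : List (ℕ × List ℕ)} {L : List ℕ}
    {codes : List (List ℕ)} {extra : List ℕ} (h : checkBlockCXSEnc k W' f cells later L codes extra = true) :
    checkBlockCX k W' f cells later L (codes.map fun g => g.map decodeName) extra = true := by
  rw [← checkBlockCXS_eq]; exact h

/-- From the strict encoded check (`decodeName2`) to the registered form. [folklore] -/
theorem checkBlockCX_of_S2 {k W' f : ℕ} {cells later : List (ℕ × List ℕ)} {L : List ℕ}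
    {codes : List (List ℕ)} {extra : List ℕ} (h : checkBlockCXSEnc2 k W' f cells later L codes extra = true) :
    checkBlockCX k W' f cells later L (codes.map fun g => g.map decodeName2) extra = true := by
  rw [← checkBlockCXS_eq]; exact h

/-- Provenance given the two masks, empty entries short-circuited, strict spread. [folklore] -/
def checkExtraSAux (k mask higher : ℕ) (L : List ℕ) : List ℕ → List (List (List ℕ × List ℕ)) → Bool
  | [], [] => true
  | e :: es, g :: gs => (bif e == 0 then g.isEmpty else
      (g.all (validName k) && (rowBitsG k g &&& higher == 0) &&
        Nat.beq (spreadS L e 0) (rowBitsG k g &&& mask))) && checkExtraSAux k mask higher L es gs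
  | _, _ => false

/-- `checkExtraSAux` is `checkExtraZAux`. [folklore] -/
theorem checkExtraSAux_eq (k mask higher : ℕ) (L : List ℕ) :
    ∀ (es : List ℕ) (gs : List (List (List ℕ × List ℕ))),
      checkExtraSAux k mask higher L es gs = checkExtraZAux k mask higher L es gs
  | [], [] => rfl
  | [], _ :: _ => rfl
  | _ :: _, [] => rfl
  | e :: es, g :: gs => by rw [checkExtraSAux, checkExtraZAux, spreadS_eq, checkExtraSAux_eq k mask higher L es gs]

/-- **Provenance, strict spread** (same Boolean as `checkExtraZ`). [cite: IharaKanekoZagier2006, §2] -/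
def checkExtraS (k : ℕ) (cells later : List (ℕ × List ℕ)) (L : List ℕ) (extra : List ℕ)
    (pgroups : List (List (List ℕ × List ℕ))) : Bool :=
  checkExtraSAux k (cellsMask k cells &&& colMask k) (cellsMask k later) L extra pgroups

/-- **`checkExtraS ⇒ checkExtra`**. [folklore] -/
theorem checkExtra_of_checkExtraS {k : ℕ} {cells later : List (ℕ × List ℕ)} {L : List ℕ}
    {extra : List ℕ} {pgroups : List (List (List ℕ × List ℕ))}
    (h : checkExtraS k cells later L extra pgroups = true) : checkExtra k cells later L extra pgroups = true :=
  checkExtra_of_checkExtraZ (by rw [checkExtraZ, ← checkExtraSAux_eq]; exact h)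

/-- Sanity (kernel): the weight-`5` examples of `cellsX_sanity` / `cellsZ_sanity` / `cells2_sanity` in
the strict forms. [folklore] -/
theorem cellsS_sanity : spreadS [7, 15, 11, 13] 5 0 = 2 ^ 7 + 2 ^ 11 ∧
    checkBlockCXSEnc 5 7 2 [(3, []), (4, [])] [] [7, 15, 11, 13]
      [[1507331], [], [327691], [327693]] [0, 5, 0, 0] = true ∧
    checkBlockCXSEnc2 5 7 2 [(3, []), (4, [])] [] [7, 15, 11, 13]
      [[23 * 2 ^ 20 + 3], [], [5 * 2 ^ 20 + 11], [5 * 2 ^ 20 + 13]] [0, 5, 0, 0] = true ∧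
    checkExtraS 5 [(3, []), (4, [])] [] [7, 15, 11, 13] [0, 5, 0, 0] [[], [([3, 1], [1])], [], []] = true ∧
    checkExtraS 5 [(3, []), (4, [])] [] [7, 15, 11, 13] [7] [[([3, 1], [1])]] = false := by
  refine ⟨?_, ?_, ?_, ?_, ?_⟩ <;> decide +kernel

/-! ### §19 Index-based spread (no halving chain at all)

Measured on the farm after §18: the strict form is NOT the cure — 46 spreads of a 1001-column list
take 513 s with `spreadS` (747 s with `spread`), and the bare halving loop (`ν ↦ ν / 2` with a
parity test at each of the 1001 steps, nothing else) already takes 525 s for 46 values, while 46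
passes OR-ing `2 ^ c` over the same list take 9 s: under the kernel, a chain of arithmetic through
a recursion argument that is forced at every step is re-evaluated from its origin each time
(quadratic), whereas a chain forced once at the end is linear. `spreadJ` therefore never halves:
it reads bit `j` of the ORIGINAL numeral (`(ν >>> j) % 2`, one GMP operation on two literals) with
the index `j` taken from `List.range` (whose elements the kernel produces as literals), and ORs
`2 ^ c * bit` into an accumulator that is forced once (46 spreads: 14 s; 184 spreads: 14 s).
`checkBlockCXJ` / `checkExtraJ` are the §15–16 checks with `spreadJ`, provably equal to them. -/

/-- Spread by explicit bit indices: for each `(c, j)`, OR `2^c` in iff bit `j` of `ν` is set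
(tail-recursive, accumulator forced once). [folklore] -/
def spreadJ (ν : ℕ) : List (ℕ × ℕ) → ℕ → ℕ
  | [], acc => acc
  | (c, j) :: rest, acc => spreadJ ν rest (acc ||| 2 ^ c * ((ν >>> j) % 2))

/-- `spreadJ` along `L` zipped with consecutive indices from `j₀` is `spread` of `ν / 2^j₀`.
[folklore] -/
theorem spreadJ_zip_range' (ν : ℕ) : ∀ (L : List ℕ) (j₀ m acc : ℕ), L.length ≤ m →
    spreadJ ν (List.zip L (List.range' j₀ m)) acc = spread L (ν / 2 ^ j₀) acc
  | [], j₀, m, acc, _ => by cases m <;> rfl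
  | c :: cs, j₀, 0, acc, h => by simp at h
  | c :: cs, j₀, m + 1, acc, h => by
    rw [List.range'_succ, List.zip_cons_cons, spreadJ, spread,
      spreadJ_zip_range' ν cs (j₀ + 1) m _ (by simpa using h)]
    congr 1
    · rw [Nat.pow_succ, ← Nat.div_div_eq_div_mul]
    · rw [Nat.shiftRight_eq_div_pow]
      rcases Nat.mod_two_eq_zero_or_one (ν / 2 ^ j₀) with h0 | h1
      · simp [h0]
      · simp [h1]

/-- The column list zipped with its indices `0, 1, …` (the kernel produces the indices of
`List.range` as literals). [folklore] -/
def zipIdx (L : List ℕ) : List (ℕ × ℕ) := List.zip L (List.range (lengthTR L))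

/-- `spreadJ` over `zipIdx L` is `spread L`. [folklore] -/
theorem spreadJ_zipIdx (L : List ℕ) (ν : ℕ) : spreadJ ν (zipIdx L) 0 = spread L ν 0 := by
  rw [zipIdx, lengthTR_eq, List.range_eq_range', spreadJ_zip_range' ν L 0 L.length 0 le_rfl]
  simp

/-- The rows of a block with extras, index-based spread (`LJ = zipIdx L`). [folklore] -/
def rowsXJ (k : ℕ) (LJ : List (ℕ × ℕ)) : List (List (List ℕ × List ℕ)) → List ℕ → List ℕ
  | g :: gs, e :: es => (bif e == 0 then rowBitsG k g else rowBitsG k g ^^^ spreadJ e LJ 0) :: rowsXJ k LJ gs es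
  | _, _ => []

/-- `rowsXJ k (zipIdx L)` is `rowsX k L`. [folklore] -/
theorem rowsXJ_eq (k : ℕ) (L : List ℕ) :
    ∀ (gs : List (List (List ℕ × List ℕ))) (es : List ℕ), rowsXJ k (zipIdx L) gs es = rowsX k L gs es
  | [], [] => rfl
  | [], _ :: _ => rfl
  | _ :: _, [] => rfl
  | g :: gs, e :: es => by rw [rowsXJ, rowsX, spreadJ_zipIdx, rowsXJ_eq k L gs es]

/-- **One cell block with extras, index-based spread** (same Boolean as `checkBlockCX`).
[cite: IharaKanekoZagier2006, Conjecture 1] -/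
def checkBlockCXJ (k W' f : ℕ) (cells later : List (ℕ × List ℕ)) (L : List ℕ)
    (groups : List (List (List ℕ × List ℕ))) (extra : List ℕ) : Bool :=
  let mask := cellsMask k cells &&& colMask k
  let higher := cellsMask k later
  let n := lengthTR L
  let rows := rowsXJ k (zipIdx L) groups extra
  Nat.beq (lengthTR groups) n && sameLength groups extra && Nat.beq (maskOf L) mask && incMod W' L &&
    Nat.blt n W' && groups.all (fun g => g.all (validName k)) &&
    (groups.map (rowBitsG k)).all (fun r => r &&& higher == 0) &&
    elimLoop W' (rep W' n) (L.map (· % W')) (pack W' (rows.map fun r => xorFold W' f (r &&& mask)))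

/-- `checkBlockCXJ` is `checkBlockCX`. [folklore] -/
theorem checkBlockCXJ_eq (k W' f : ℕ) (cells later : List (ℕ × List ℕ)) (L : List ℕ)
    (groups : List (List (List ℕ × List ℕ))) (extra : List ℕ) :
    checkBlockCXJ k W' f cells later L groups extra = checkBlockCX k W' f cells later L groups extra := by
  simp only [checkBlockCXJ, checkBlockCX, rowsXJ_eq]

/-- Encoded names (`decodeName`), index-based spread. [cite: IharaKanekoZagier2006, Conjecture 1] -/
def checkBlockCXJEnc (k W' f : ℕ) (cells later : List (ℕ × List ℕ)) (L : List ℕ)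
    (codes : List (List ℕ)) (extra : List ℕ) : Bool :=
  checkBlockCXJ k W' f cells later L (codes.map fun g => g.map decodeName) extra

/-- Encoded names (`decodeName2`), index-based spread. [cite: IharaKanekoZagier2006, Conjecture 1] -/
def checkBlockCXJEnc2 (k W' f : ℕ) (cells later : List (ℕ × List ℕ)) (L : List ℕ)
    (codes : List (List ℕ)) (extra : List ℕ) : Bool :=
  checkBlockCXJ k W' f cells later L (codes.map fun g => g.map decodeName2) extra

/-- From the index-based encoded check to the registered form. [folklore] -/
theorem checkBlockCX_of_J {k W' f : ℕ} {cells later : List (ℕ × List ℕ)} {L : List ℕ}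
    {codes : List (List ℕ)} {extra : List ℕ} (h : checkBlockCXJEnc k W' f cells later L codes extra = true) :
    checkBlockCX k W' f cells later L (codes.map fun g => g.map decodeName) extra = true := by
  rw [← checkBlockCXJ_eq]; exact h

/-- From the index-based encoded check (`decodeName2`) to the registered form. [folklore] -/
theorem checkBlockCX_of_J2 {k W' f : ℕ} {cells later : List (ℕ × List ℕ)} {L : List ℕ}
    {codes : List (List ℕ)} {extra : List ℕ} (h : checkBlockCXJEnc2 k W' f cells later L codes extra = true) :
    checkBlockCX k W' f cells later L (codes.map fun g => g.map decodeName2) extra = true := by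
  rw [← checkBlockCXJ_eq]; exact h

/-- Provenance given the two masks, empty entries short-circuited, index-based spread. [folklore] -/
def checkExtraJAux (k mask higher : ℕ) (LJ : List (ℕ × ℕ)) : List ℕ → List (List (List ℕ × List ℕ)) → Bool
  | [], [] => true
  | e :: es, g :: gs => (bif e == 0 then g.isEmpty else
      (g.all (validName k) && (rowBitsG k g &&& higher == 0) &&
        Nat.beq (spreadJ e LJ 0) (rowBitsG k g &&& mask))) && checkExtraJAux k mask higher LJ es gs
  | _, _ => false

/-- `checkExtraJAux … (zipIdx L)` is `checkExtraZAux … L`. [folklore] -/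
theorem checkExtraJAux_eq (k mask higher : ℕ) (L : List ℕ) :
    ∀ (es : List ℕ) (gs : List (List (List ℕ × List ℕ))),
      checkExtraJAux k mask higher (zipIdx L) es gs = checkExtraZAux k mask higher L es gs
  | [], [] => rfl
  | [], _ :: _ => rfl
  | _ :: _, [] => rfl
  | e :: es, g :: gs => by rw [checkExtraJAux, checkExtraZAux, spreadJ_zipIdx, checkExtraJAux_eq k mask higher L es gs]

/-- **Provenance, index-based spread** (same Boolean as `checkExtraZ`). [cite: IharaKanekoZagier2006, §2] -/
def checkExtraJ (k : ℕ) (cells later : List (ℕ × List ℕ)) (L : List ℕ) (extra : List ℕ)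
    (pgroups : List (List (List ℕ × List ℕ))) : Bool :=
  checkExtraJAux k (cellsMask k cells &&& colMask k) (cellsMask k later) (zipIdx L) extra pgroups

/-- **`checkExtraJ ⇒ checkExtra`**. [folklore] -/
theorem checkExtra_of_checkExtraJ {k : ℕ} {cells later : List (ℕ × List ℕ)} {L : List ℕ}
    {extra : List ℕ} {pgroups : List (List (List ℕ × List ℕ))}
    (h : checkExtraJ k cells later L extra pgroups = true) : checkExtra k cells later L extra pgroups = true :=
  checkExtra_of_checkExtraZ (by rw [checkExtraZ, ← checkExtraJAux_eq]; exact h)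

/-- Sanity (kernel): the weight-`5` examples in the index-based forms. [folklore] -/
theorem cellsJ_sanity : spreadJ 5 (zipIdx [7, 15, 11, 13]) 0 = 2 ^ 7 + 2 ^ 11 ∧
    checkBlockCXJEnc 5 7 2 [(3, []), (4, [])] [] [7, 15, 11, 13]
      [[1507331], [], [327691], [327693]] [0, 5, 0, 0] = true ∧
    checkBlockCXJEnc2 5 7 2 [(3, []), (4, [])] [] [7, 15, 11, 13]
      [[23 * 2 ^ 20 + 3], [], [5 * 2 ^ 20 + 11], [5 * 2 ^ 20 + 13]] [0, 5, 0, 0] = true ∧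
    checkExtraJ 5 [(3, []), (4, [])] [] [7, 15, 11, 13] [0, 5, 0, 0] [[], [([3, 1], [1])], [], []] = true ∧
    checkExtraJ 5 [(3, []), (4, [])] [] [7, 15, 11, 13] [7] [[([3, 1], [1])]] = false := by
  refine ⟨?_, ?_, ?_, ?_, ?_⟩ <;> decide +kernel

end LinEDS

end Literature.NumberTheory.Transcendental
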